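import Literature.MathematicalPhysics.QuantumFieldTheory.Balaban1983to89.T3PrintedRegularMinimiserReduction
import Literature.MathematicalPhysics.QuantumFieldTheory.Balaban1983to89.T3ThresholdSmallness
import HarnessLib

/-!
# `Balaban1983to89.T3LowerAlongMinimisersSplit` — rung R3, crux K1, child «MinimiserStabilityRegPr», stub LOWER
# (`LowerAlongRegPrMinimisersAt`, cell gap G-K1a-3 «AVG-INEQ along minimisers»): the competitor NAMED (the one-step (0.4)-average of
# print's run-`(K+1)` minimiser), the stub SPLIT into «the average is an admissible competitor» ([Balaban1985Averaging] Prop 1 for (0.4) +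
# [Balaban1985Variational] Prop 8 + a located divergence-clause statement) ∧ «the d = 3 averaging action inequality» (printed in kind,
# [Federbush1987PhaseCellIII] Thm 4.3), and the composition PROVED under the route's prefix

Cell `ym3-torus` (HUMAN RULING D-0037, YM ladder rung R3), seat `ym3-torus-p1` gen 6 (UV side); cell record HOME/UV3-NODE.md §14.  WHAT THIS
IS NOT: no estimate and NOT a proof of the stub — every analytic statement below is a HYPOTHESIS SCHEMA (never asserted); what is PROVED is
the bookkeeping that composes them into `T3PrintedRegularMinimiserReduction.LowerAlongRegPrMinimisersAt` under the route's quantifier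
prefix, the fibre identity of the competitor (tree `T3DescentFibreTower.descendTo_mem_fibre`), the plaquette clause of its regularity from
[Balaban1985Averaging] Prop 1 (51) read for the family's averaging, and the scale arithmetic `β_{K+1} = L·β_K`.

THE POINT.  `LowerAlongRegPrMinimisersAt F γ b₀ p₀ m ε₀` asks: eventually in `K`, for every `θBal(⌊K/m⌋)`-small datum `V` and every
minimiser `U′` of the Wilson action over print's regular fibre (6) of run `K+1` over `V`, SOME printed-regular run-`K` configuration `U` in
the fibre of `V` with `β_K A(U) ≤ β_{K+1} A(U′) + r_K`, `Σ r_K < ∞`.  The competitor of record is the ONE-STEP AVERAGE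
`U := D_{K,K+1}U′ = descendTo F ℰp K (K+1) _ U′` (it lies in the fibre of `V` by the descent tower, PROVED); the stub then splits into
* ADMISSIBILITY — `U ∈ 𝔘_{K−n}(ε₀)` in full: (i) the minimiser lies in (8) (radius `B₃ε₁`, `ε₁ = θBal(n)`): schema **`MinimisersIn8At`**
  ([Balaban1985Variational] Prop 8 p. 304 «if U is a critical configuration of (5) in the space (6) … then U belongs to the space (8)»
  with Thm 1; a minimiser over the open space (6) is critical); (ii) plaquette clause of the average: schema **`Prop1EmlAt`**
  ([Balaban1985Averaging] Prop 1 (51) «|V̄(∂p′) − 1| < L²α₀ + C₀(L²α₀)²», ONE averaging step, for the family's (0.4)/`ℰp` averaging —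
  printed for the averaging (15), transported by [Balaban1987RG1] p. 253's universality sentence; cell gap G-K1a-5's «Prop 1 for (0.4)»)
  — from (i)+(ii) the average has plaquettes `< B₃ε₁L^{−2(K−n)}(1 + C₀B₃ε₁) ≤ ε₀L^{−2(K−n)}` once `C₀B₃ε₁ ≤ 1`, `2B₃ε₁ ≤ ε₀` (PROVED,
  `plaqSmall_descendTo_of_mem8`); (iii) divergence clause of the average: schema **`AvgDivSmallAt`** — NOT PRINTED as a statement
  (located gap **G-K1a-3a**; expected from the minimiser's regularity (9)–(10) p. 279 and the expansion of the averaged field's curvature,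
  [Balaban1985Averaging] Props 3–4);
* THE INEQUALITY — schema **`AvgActionIneqAt`**: `β_K A(D_{K,K+1}U′) ≤ β_{K+1}A(U′) + r_K` along print's run-`(K+1)` minimisers
  (equivalently, by `β_{K+1} = L·β_K` (`scheme_β_succ`), `A_K(Ū′) ≤ L·A_{K+1}(U′) + r_K/β_K`: the d = 3 scaling `A_coarse ≈ L^{4−d}A_fine`
  of a smooth field, exact at leading order for the quadratic part by Cauchy–Schwarz, with cubic corrections summable along regular
  minimisers iff `m ≥ 3`, cell memo §11.3) — PRINTED IN KIND: [Federbush1987PhaseCellIII] Thms 4.1–4.3 (4.3)–(4.5) for Federbush's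
  averaging and modified action (tree `Federbush1986.LocalStabilitySUN.eq525_family_SUN`); for (0.4)/Wilson: located gap **G-K1a-3b**.
* **`lowerAlongRegPrMinimisersAt_of_split`** (PROVED): `MinimisersIn8At ∧ Prop1EmlAt ∧ AvgDivSmallAt` (print-style, constants
  `a₀ a₁ B₃ C₀ c₂′`) ⇒ `∃ ε₁′ > 0, ∀ ε₀ ∈ (0, ε₁′], ∀ m ≥ 2, ∀ b₀ > 0, ∀ p₀, ∃ γ₁ > 0, ∀ F γ, F.L = L → 0 < γ ≤ γ₁ →
  AvgActionIneqAt F γ b₀ p₀ m ε₀ B₃ → LowerAlongRegPrMinimisersAt F γ b₀ p₀ m ε₀` — the thresholds «`θ ≤ a₁`, `2B₃θ ≤ ε₀`,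
  `C₀B₃θ ≤ 1`, `B₃θ ≤ c₂′`» at every height discharged by `T3ThresholdSmallness.exists_forall_θBal_le`.

References: T. Bałaban, CMP 102 (1985) 277–309 [Balaban1985Variational] (Thm 1 (8)–(10) p.279, Prop 8 p.304); CMP 98 (1985) 17–51
[Balaban1985Averaging] (Prop 1 (51) p.26, Props 3–4 pp.36–39); CMP 109 (1987) 249–301 [Balaban1987RG1] ((0.4), p.253); CMP 102 (1985)
255–275 [Balaban1985UV3] ((3)/(5) p.256: `g_k² = g²L^kε`, i.e. `β_{K+1} = Lβ_K`); P. Federbush, CMP 110 (1987) 293–309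
[Federbush1987PhaseCellIII] (Thm 4.3 (4.5) p.299); C. King, CMP 102 (1986) 649–677 [King1986] (App. (A.5)).
-/

noncomputable section

open MeasureTheory Filter Topology
open Literature.MathematicalPhysics.QuantumFieldTheory.Balaban1983to89.T3ContinuumYM3Torus
open Literature.MathematicalPhysics.QuantumFieldTheory.Balaban1983to89.T3UnitLawDensityEML (ℰp measurableE_ℰp)
open Literature.MathematicalPhysics.QuantumFieldTheory.Balaban1983to89.T3UnitScaleTilt
open Literature.MathematicalPhysics.QuantumFieldTheory.Balaban1983to89.T3TiltDescent
open Literature.MathematicalPhysics.QuantumFieldTheory.Balaban1983to89.T3ConstrainedMinimiser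
open Literature.MathematicalPhysics.QuantumFieldTheory.Balaban1983to89.T3DescentFibreTower
open Literature.MathematicalPhysics.QuantumFieldTheory.Balaban1983to89.T3MinimiserStabilityReduction
open Literature.MathematicalPhysics.QuantumFieldTheory.Balaban1983to89.T3RegularMinimiser
open Literature.MathematicalPhysics.QuantumFieldTheory.Balaban1983to89.T3PrintedRegularMinimiser
open Literature.MathematicalPhysics.QuantumFieldTheory.Balaban1983to89.T3PrintedRegularMinimiserReduction
open Literature.MathematicalPhysics.QuantumFieldTheory.Balaban1983to89.T3ThresholdSmallness (exists_forall_θBal_le)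
open Literature.MathematicalPhysics.QuantumFieldTheory.Balaban1983to89.Missing

namespace Literature.MathematicalPhysics.QuantumFieldTheory.Balaban1983to89.T3LowerAlongMinimisersSplit

/-! ## §1 Scale arithmetic of the family: `β_{K+1} = L·β_K`, and the one-step threshold identity -/

section Scale

variable (F : T3Family)

/-- **`β_{K+1} = L·β_K`**: the bare inverse couplings of consecutive runs (`β_K = (γε_K)⁻¹`, `ε_K = L^{−K}`) differ by the block factor —
d = 3 superrenormalisability `g_k² = g²L^kε` read on the family. [cite: Balaban1985UV3, (3) and (5) p.256] -/
theorem scheme_β_succ (γ : ℝ) (K : ℕ) : (F.scheme ℰp γ).β (K + 1) = (F.L : ℝ) * (F.scheme ℰp γ).β K := by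
  show (γ * (F.P (K + 1)).eps)⁻¹ = (F.L : ℝ) * (γ * (F.P K).eps)⁻¹
  have h1 : (F.P (K + 1)).eps = ((F.L : ℝ)⁻¹) ^ (K + 1) := rfl
  have h2 : (F.P K).eps = ((F.L : ℝ)⁻¹) ^ K := rfl
  rw [h1, h2, pow_succ, ← mul_assoc, mul_inv, inv_inv, mul_comm]

/-- `0 < L` for the family (bookkeeping). [cite: Balaban1985UV3, (1)-(3) p.256] -/
theorem L_cast_pos : (0 : ℝ) < F.L := by exact_mod_cast lt_trans zero_lt_one F.hL.2

/-- The one-step threshold identity `L²·(ε·L^{−2(K+1−n)}) = ε·L^{−2(K−n)}` (`n ≤ K`): a bound `ε` at the cut-off of run `K+1` read one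
level up. [cite: Balaban1985Averaging, (51) p.26] -/
theorem sq_mul_regThreshold_succ {n K : ℕ} (h : n ≤ K) (ε : ℝ) :
    (F.L : ℝ) ^ 2 * regThreshold F n (K + 1) ε = regThreshold F n K ε := by
  have hL : (F.L : ℝ) ≠ 0 := (L_cast_pos F).ne'
  unfold regThreshold
  rw [show 2 * (K + 1 - n) = 2 * (K - n) + 2 by omega, pow_add, inv_pow, inv_pow]
  field_simp

/-- `0 < L^{−2(K−n)} ≤ 1` (bookkeeping). [cite: Balaban1985Variational, (2) p.278] -/
theorem scale_pos_le_one (a : ℕ) : 0 < ((F.L : ℝ)⁻¹) ^ a ∧ ((F.L : ℝ)⁻¹) ^ a ≤ 1 :=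
  ⟨pow_pos (inv_pos.mpr (L_cast_pos F)) a,
    pow_le_one₀ (inv_nonneg.mpr (L_cast_pos F).le) (inv_le_one_of_one_le₀ (by exact_mod_cast F.hL.2.le))⟩

end Scale

/-! ## §2 The schemas (hypotheses, never asserted) -/

section Schemas

/-- **[Balaban1985Averaging] PROP 1 (51) FOR THE FAMILY'S (0.4)-AVERAGING, ONE STEP, AT GIVEN CONSTANTS** (hypothesis schema, never
asserted): if every plaquette variable of a configuration on the finest lattice of run `K+1` is within `a ≤ c₂′` of `1`, then every
plaquette variable of its one-step block average (a configuration on the finest lattice of run `K`) is within `L²a + C₀(L²a)²` of `1`.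
Printed («|V̄(∂p′) − 1| < L²α₀ + C₀(L²α₀)² (51)», `C₀ = C₀(d)`, `c₂′ = c₂′(d, L)`) for the averaging (15) with the local hypothesis (44) on
`Δ(p′)` (here strengthened to all plaquettes); for (0.4) by [Balaban1987RG1] p. 253's universality sentence (cell gap G-K1a-5).
[cite: Balaban1985Averaging, Prop. 1 (51) p.26] -/
def Prop1EmlAt (L : ℕ) (C₀ c₂' : ℝ) : Prop :=
  ∀ F : T3Family, F.L = L → ∀ (K : ℕ) (a : ℝ), 0 < a → a ≤ c₂' →
    ∀ U : GaugeField (F.P (K + 1)) 0 (Matrix.specialUnitaryGroup (Fin 2) ℂ), PlaqSmall a U →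
      PlaqSmall ((L : ℝ) ^ 2 * a + C₀ * ((L : ℝ) ^ 2 * a) ^ 2) (descendTo F ℰp K (K + 1) (Nat.le_succ K) U)

/-- **[Balaban1985Variational] PROP 8 WITH THM 1: MINIMISERS OVER (6) LIE IN (8), AT GIVEN CONSTANTS** (hypothesis schema, never asserted):
for `0 < ε₁ ≤ a₁`, `B₃ε₁ ≤ ε₀ ≤ a₀`, `n < K` and a datum `V` satisfying (7), every minimiser of the Wilson action over print's space (6)
= `regFibrePr F n K _ ε₀ V` lies in (8) = `regFibrePr F n K _ (B₃ε₁) V`.  Print: Prop 8 p. 304 «if U is a critical configuration of (5) in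
the space (6) with V satisfying (7), and if ε₀ ≤ a₅, then U belongs to the space (8)» (a minimiser over the open space (6) is critical; the
constant `a₅` is absorbed in Thm 1's `a₀`); for the family's (0.4)-fibres by [Balaban1987RG1] p. 253. [cite: Balaban1985Variational, Prop 8 p.304] -/
def MinimisersIn8At (L : ℕ) (a₀ a₁ B₃ : ℝ) : Prop :=
  ∀ F : T3Family, F.L = L → ∀ (n K : ℕ) (hnK : n < K) (ε₁ ε₀ : ℝ), 0 < ε₁ → ε₁ ≤ a₁ → B₃ * ε₁ ≤ ε₀ → ε₀ ≤ a₀ →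
    ∀ V : GaugeField (F.P n) 0 (Matrix.specialUnitaryGroup (Fin 2) ℂ), PlaqSmall ε₁ V →
      ∀ U ∈ regFibrePr F n K hnK.le ε₀ V,
        IsMinOn (fun W : GaugeField (F.P K) 0 (Matrix.specialUnitaryGroup (Fin 2) ℂ) => wilsonAction4 W) (regFibrePr F n K hnK.le ε₀ V) U →
          U ∈ regFibrePr F n K hnK.le (B₃ * ε₁) V

/-- **LOCATED GAP G-K1a-3a AS A SCHEMA — THE DIVERGENCE CLAUSE OF THE AVERAGED MINIMISER** (hypothesis, never asserted; NOT PRINTED as a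
statement): for `0 < ε₁ ≤ a₁`, `B₃ε₁ ≤ ε₀ ≤ a₀`, `n < K`, (7)-data `V`, and every minimiser `U′` of the Wilson action over print's space (6)
of run `K+1` lying in (8), the one-step (0.4)-average `D_{K,K+1}U′` satisfies the covariant-divergence clause [Balaban1985RegularSpaces]
(1.9) at run `K`'s cut-off with radius `ε₀`: `‖D^{1*}∂(D_{K,K+1}U′)‖ < ε₀L^{−3(K−n)}`.  Expected from the minimiser's regularity (9)–(10)
p. 279 (`|∇^ηA|`, `|Δ^ηA| = O(ε₁)` in continuum units) and the curvature expansion of averaged fields ([Balaban1985Averaging] Props 3–4);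
print states neither the clause for averages nor its constant. [cite: Balaban1985Variational, (9)-(10) p.279] -/
def AvgDivSmallAt (L : ℕ) (a₀ a₁ B₃ : ℝ) : Prop :=
  ∀ F : T3Family, F.L = L → ∀ (n K : ℕ) (hnK : n < K) (ε₁ ε₀ : ℝ), 0 < ε₁ → ε₁ ≤ a₁ → B₃ * ε₁ ≤ ε₀ → ε₀ ≤ a₀ →
    ∀ V : GaugeField (F.P n) 0 (Matrix.specialUnitaryGroup (Fin 2) ℂ), PlaqSmall ε₁ V →
      ∀ U' ∈ regFibrePr F n (K + 1) (hnK.le.trans (Nat.le_succ K)) (B₃ * ε₁) V,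
        IsMinOn (fun W : GaugeField (F.P (K + 1)) 0 (Matrix.specialUnitaryGroup (Fin 2) ℂ) => wilsonAction4 W)
            (regFibrePr F n (K + 1) (hnK.le.trans (Nat.le_succ K)) ε₀ V) U' →
          DivSmall F n K ε₀ (descendTo F ℰp K (K + 1) (Nat.le_succ K) U')

/-- **LOCATED GAP G-K1a-3b AS A SCHEMA — THE d = 3 AVERAGING ACTION INEQUALITY ALONG PRINT'S RUN-`(K+1)` MINIMISERS** (hypothesis, never
asserted; printed IN KIND): summable `r_K ≥ 0` and `K₀` such that for `K ≥ K₀`, every `θBal(⌊K/m⌋)`-small datum `V` and every minimiser `U′`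
of the Wilson action over print's space (6) of run `K+1` lying in (8) (radius `B₃θBal(⌊K/m⌋)`):
`β_K·A(D_{K,K+1}U′) ≤ β_{K+1}·A(U′) + r_K`, i.e. (`β_{K+1} = Lβ_K`) `A_K(Ū′) ≤ L·A_{K+1}(U′) + r_K/β_K` — the coarse action of the one-step
average is at most `L = L^{4−d}` times the fine action up to a summable error (quadratic part: Cauchy–Schwarz over the `L²` translated
plaquettes, no loss; cubic corrections `≲ f₂B₃³θ³·L^{K(9/(2m)−2)}`, summable iff `m ≥ 3`).  PRINTED for Federbush's averaging and modified
action: [Federbush1987PhaseCellIII] Thms 4.1–4.3, (4.5) «coarse ≤ N^{4−d}·fine + f₂(Σ|A_{∂p}|²)^{3/2}» (tree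
`Federbush1986.LocalStabilitySUN.eq525_family_SUN`); for the (0.4) averaging and the Wilson action: NOT printed (cell gap G-K1a-3, PORT).
[cite: Federbush1987PhaseCellIII, Thm 4.3 (4.5) p.299] -/
def AvgActionIneqAt (F : T3Family) (γ b₀ p₀ : ℝ) (m : ℕ) (ε₀ B₃ : ℝ) : Prop :=
  ∃ (K₀ : ℕ) (r : ℕ → ℝ), Summable r ∧ (∀ K, 0 ≤ r K) ∧
    ∀ K, K₀ ≤ K → ∀ (V : GaugeField (F.P (K / m)) 0 (Matrix.specialUnitaryGroup (Fin 2) ℂ)),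
      PlaqSmall (θBal F.L γ b₀ p₀ (K / m)) V →
        ∀ U' ∈ regFibrePr F (K / m) (K + 1) ((Nat.div_le_self K m).trans (Nat.le_succ K)) (B₃ * θBal F.L γ b₀ p₀ (K / m)) V,
          IsMinOn (fun W : GaugeField (F.P (K + 1)) 0 (Matrix.specialUnitaryGroup (Fin 2) ℂ) => wilsonAction4 W)
              (regFibrePr F (K / m) (K + 1) ((Nat.div_le_self K m).trans (Nat.le_succ K)) ε₀ V) U' →
            (F.scheme ℰp γ).β K * wilsonAction4 (descendTo F ℰp K (K + 1) (Nat.le_succ K) U') ≤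
              (F.scheme ℰp γ).β (K + 1) * wilsonAction4 U' + r K

/-- The scale-free form of the inequality: `A_K(Ū′) ≤ L·A_{K+1}(U′) + e` iff `β_K A_K(Ū′) ≤ β_{K+1}A_{K+1}(U′) + β_K·e` (`γ > 0`), by
`β_{K+1} = Lβ_K`. [cite: Balaban1985UV3, (3) and (5) p.256] -/
theorem weighted_iff_scaleFree (F : T3Family) {γ : ℝ} (hγ : 0 < γ) (K : ℕ) (a a' e : ℝ) :
    (F.scheme ℰp γ).β K * a ≤ (F.scheme ℰp γ).β (K + 1) * a' + (F.scheme ℰp γ).β K * e ↔ a ≤ (F.L : ℝ) * a' + e := by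
  have hβ : 0 < (F.scheme ℰp γ).β K := by
    show 0 < (γ * (F.P K).eps)⁻¹
    exact inv_pos.mpr (mul_pos hγ (F.P K).eps_pos)
  rw [scheme_β_succ, show (F.L : ℝ) * (F.scheme ℰp γ).β K * a' + (F.scheme ℰp γ).β K * e =
    (F.scheme ℰp γ).β K * ((F.L : ℝ) * a' + e) by ring]
  exact ⟨fun h => le_of_mul_le_mul_left h hβ, fun h => mul_le_mul_of_nonneg_left h hβ.le⟩

end Schemas

/-! ## §3 The competitor: the one-step average of the run-`(K+1)` minimiser lies in print's regular fibre of run `K` -/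

section Competitor

variable (F : T3Family)

/-- **PLAQUETTE CLAUSE OF THE AVERAGED MINIMISER** (PROVED from `Prop1EmlAt`): if `U′ ∈ (8)_{K+1}` (plaquettes `< B₃ε₁L^{−2(K+1−n)}`), then
its one-step average has plaquettes `< B₃ε₁L^{−2(K−n)}(1 + C₀B₃ε₁L^{−2(K−n)}) ≤ ε₀L^{−2(K−n)}` provided `C₀B₃ε₁ ≤ 1`, `2B₃ε₁ ≤ ε₀` and
`B₃ε₁ ≤ c₂′` (no sign condition on `C₀` is needed). [cite: Balaban1985Averaging, Prop. 1 (51) p.26] -/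
theorem plaqSmall_descendTo_of_mem8 {L : ℕ} {C₀ c₂' : ℝ} (hP1 : Prop1EmlAt L C₀ c₂') (hF : F.L = L)
    {n K : ℕ} (hnK : n ≤ K) {B₃ ε₁ ε₀ : ℝ} (hBε : 0 < B₃ * ε₁) (hc : B₃ * ε₁ ≤ c₂') (hC : C₀ * (B₃ * ε₁) ≤ 1)
    (h2 : 2 * (B₃ * ε₁) ≤ ε₀) {V : GaugeField (F.P n) 0 (Matrix.specialUnitaryGroup (Fin 2) ℂ)}
    {U' : GaugeField (F.P (K + 1)) 0 (Matrix.specialUnitaryGroup (Fin 2) ℂ)}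
    (hU' : U' ∈ regFibrePr F n (K + 1) (hnK.trans (Nat.le_succ K)) (B₃ * ε₁) V) :
    PlaqSmall (regThreshold F n K ε₀) (descendTo F ℰp K (K + 1) (Nat.le_succ K) U') := by
  -- the fine bound `a := B₃ε₁·L^{−2(K+1−n)}`
  set a := regThreshold F n (K + 1) (B₃ * ε₁) with ha_def
  obtain ⟨hs, hs1⟩ := scale_pos_le_one F (2 * (K + 1 - n))
  have ha : 0 < a := mul_pos hBε hs
  have hac : a ≤ c₂' := (mul_le_of_le_one_right hBε.le hs1).trans hc
  have hplaq : PlaqSmall a U' := hU'.1.2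
  have havg := hP1 F hF K a ha hac U' hplaq
  -- `L²a = B₃ε₁·L^{−2(K−n)}` and the bound is below `ε₀·L^{−2(K−n)}`
  have hLa : (L : ℝ) ^ 2 * a = regThreshold F n K (B₃ * ε₁) := by rw [← hF]; exact sq_mul_regThreshold_succ F hnK _
  rw [hLa] at havg
  refine fun p => (havg p).trans_le ?_
  obtain ⟨ht, ht1⟩ := scale_pos_le_one F (2 * (K - n))
  unfold regThreshold at *
  set t := ((F.L : ℝ)⁻¹) ^ (2 * (K - n)) with ht_def
  -- `B₃ε₁t + C₀(B₃ε₁t)² ≤ B₃ε₁t(1 + C₀B₃ε₁) ≤ 2B₃ε₁t ≤ ε₀t`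
  have h1 : C₀ * (B₃ * ε₁ * t) ^ 2 ≤ B₃ * ε₁ * t := by
    have : C₀ * (B₃ * ε₁ * t) ^ 2 = (C₀ * (B₃ * ε₁)) * t * (B₃ * ε₁ * t) := by ring
    rw [this]
    have hbt : 0 ≤ B₃ * ε₁ * t := mul_nonneg hBε.le ht.le
    calc C₀ * (B₃ * ε₁) * t * (B₃ * ε₁ * t) ≤ 1 * 1 * (B₃ * ε₁ * t) := by
          apply mul_le_mul_of_nonneg_right _ hbt
          exact mul_le_mul hC ht1 ht.le zero_le_one
      _ = B₃ * ε₁ * t := by ring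
  nlinarith [ht.le]

/-- **THE COMPETITOR IS ADMISSIBLE** (PROVED from the schemas): for a minimiser `U′` of the Wilson action over print's space (6) of run `K+1`
lying in (8), its one-step average lies in print's regular fibre (6) of run `K` over the same datum — fibre identity by the descent tower
(`descendTo_mem_fibre`), plaquette clause by `Prop1EmlAt`, divergence clause by `AvgDivSmallAt`. [cite: Balaban1985Variational, (6) p.278] -/
theorem descendTo_mem_regFibrePr {L : ℕ} {a₀ a₁ B₃ C₀ c₂' : ℝ} (hB₃ : 0 < B₃) (hP1 : Prop1EmlAt L C₀ c₂')
    (hdiv : AvgDivSmallAt L a₀ a₁ B₃) (hF : F.L = L) {n K : ℕ} (hnK : n < K) {ε₁ ε₀ : ℝ} (hε₁ : 0 < ε₁) (hε₁a : ε₁ ≤ a₁)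
    (hlo : B₃ * ε₁ ≤ ε₀) (hhi : ε₀ ≤ a₀) (hc : B₃ * ε₁ ≤ c₂') (hC : C₀ * (B₃ * ε₁) ≤ 1) (h2 : 2 * (B₃ * ε₁) ≤ ε₀)
    {V : GaugeField (F.P n) 0 (Matrix.specialUnitaryGroup (Fin 2) ℂ)} (hV : PlaqSmall ε₁ V)
    {U' : GaugeField (F.P (K + 1)) 0 (Matrix.specialUnitaryGroup (Fin 2) ℂ)}
    (hU'8 : U' ∈ regFibrePr F n (K + 1) (hnK.le.trans (Nat.le_succ K)) (B₃ * ε₁) V)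
    (hmin : IsMinOn (fun W : GaugeField (F.P (K + 1)) 0 (Matrix.specialUnitaryGroup (Fin 2) ℂ) => wilsonAction4 W)
      (regFibrePr F n (K + 1) (hnK.le.trans (Nat.le_succ K)) ε₀ V) U') :
    descendTo F ℰp K (K + 1) (Nat.le_succ K) U' ∈ regFibrePr F n K hnK.le ε₀ V :=
  ⟨⟨descendTo_mem_fibre F ℰp hnK.le (Nat.le_succ K) hU'8.1.1,
      plaqSmall_descendTo_of_mem8 F hP1 hF hnK.le (mul_pos hB₃ hε₁) hc hC h2 hU'8⟩,
    hdiv F hF n K hnK ε₁ ε₀ hε₁ hε₁a hlo hhi V hV U' hU'8 hmin⟩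

end Competitor

/-! ## §4 The composition: LOWER ⇐ the schemas, under the route's prefix -/

section Composition

/-- A minimiser of `minActionRegPr` (the stub's hypothesis `A(U′) = minActionRegPr`) minimises in the `IsMinOn` sense. [cite: Balaban1985Variational, Thm 1 (8) p.279] -/
theorem isMinOn_of_eq_minActionRegPr (F : T3Family) {n K : ℕ} {h : n ≤ K} {ε₀ : ℝ}
    {V : GaugeField (F.P n) 0 (Matrix.specialUnitaryGroup (Fin 2) ℂ)} {U : GaugeField (F.P K) 0 (Matrix.specialUnitaryGroup (Fin 2) ℂ)}
    (hU : wilsonAction4 U = minActionRegPr F n K h ε₀ V) :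
    IsMinOn (fun W : GaugeField (F.P K) 0 (Matrix.specialUnitaryGroup (Fin 2) ℂ) => wilsonAction4 W) (regFibrePr F n K h ε₀ V) U :=
  fun W hW => by
    show wilsonAction4 U ≤ wilsonAction4 W
    rw [hU]
    exact minActionRegPr_le F hW

/-- **LOWER ⇐ THE SPLIT, UNDER THE ROUTE'S PREFIX.**  Given the print-style schemas at constants `a₀, a₁, B₃, C₀, c₂′ > 0` — minimisers over
(6) lie in (8) (`MinimisersIn8At`), [Balaban1985Averaging] Prop 1 for the family's averaging (`Prop1EmlAt`), and the divergence clause of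
averaged minimisers (`AvgDivSmallAt`, G-K1a-3a) —, there is `ε₁′ > 0` (namely `a₀`) such that for every `0 < ε₀ ≤ ε₁′`, `m ≥ 2`, `b₀ > 0`,
real `p₀` there is `γ₁ > 0` such that for all `F` with `F.L = L` and `0 < γ ≤ γ₁`: the d = 3 averaging action inequality along print's
run-`(K+1)` minimisers (`AvgActionIneqAt F γ b₀ p₀ m ε₀ B₃`, G-K1a-3b) implies the stub `LowerAlongRegPrMinimisersAt F γ b₀ p₀ m ε₀`, with
the SAME summable radii and `K₀ := max K₀ 1`; the competitor is the one-step average of the minimiser.  The `γ₁` makes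
`θBal(i) ≤ min {a₁, ε₀/(2B₃), 1/(C₀B₃), c₂′/B₃}` at every height (`T3ThresholdSmallness.exists_forall_θBal_le`).
[cite: Balaban1985Variational, Thm 1 p.279 and Prop 8 p.304; Federbush1987PhaseCellIII, Thm 4.3 p.299] -/
theorem lowerAlongRegPrMinimisersAt_of_split {L : ℕ} {a₀ a₁ B₃ C₀ c₂' : ℝ} (ha₀ : 0 < a₀) (ha₁ : 0 < a₁) (hB₃ : 0 < B₃)
    (hC₀ : 0 < C₀) (hc₂ : 0 < c₂') (h8 : MinimisersIn8At L a₀ a₁ B₃) (hP1 : Prop1EmlAt L C₀ c₂') (hdiv : AvgDivSmallAt L a₀ a₁ B₃) :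
    ∃ ε₁' : ℝ, 0 < ε₁' ∧ ∀ ε₀ : ℝ, 0 < ε₀ → ε₀ ≤ ε₁' → ∀ m : ℕ, 2 ≤ m → ∀ b₀ p₀ : ℝ, 0 < b₀ →
      ∃ γ₁ : ℝ, 0 < γ₁ ∧ ∀ (F : T3Family) (γ : ℝ), F.L = L → 0 < γ → γ ≤ γ₁ →
        AvgActionIneqAt F γ b₀ p₀ m ε₀ B₃ → LowerAlongRegPrMinimisersAt F γ b₀ p₀ m ε₀ := by
  refine ⟨a₀, ha₀, fun ε₀ hε₀ hε₀a m hm b₀ p₀ hb => ?_⟩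
  by_cases hL : 1 ≤ L
  · -- the target for the thresholds at every height
    set σ : ℝ := min a₁ (min (ε₀ / (2 * B₃)) (min (1 / (C₀ * B₃)) (c₂' / B₃))) with hσ_def
    have hσ : 0 < σ := lt_min ha₁ (lt_min (by positivity) (lt_min (by positivity) (by positivity)))
    obtain ⟨γ₁, hγ₁, hθ⟩ := exists_forall_θBal_le hL b₀ p₀ hσ
    refine ⟨min γ₁ 1, lt_min hγ₁ one_pos, fun F γ hF hγ hγle hineq => ?_⟩
    have hγ₁' : γ ≤ γ₁ := hγle.trans (min_le_left _ _)
    have hγ1 : γ ≤ 1 := hγle.trans (min_le_right _ _)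
    obtain ⟨K₀, r, hr, hr0, hineq⟩ := hineq
    refine ⟨max K₀ 1, r, hr, hr0, fun K hK V hV U' hU' hU'min => ?_⟩
    have hK₀ : K₀ ≤ K := (le_max_left _ _).trans hK
    have hK1 : 1 ≤ K := (le_max_right _ _).trans hK
    have hnK : K / m < K := Nat.div_lt_self (by omega) (by omega)
    have hnK' : K / m < K + 1 := hnK.trans (Nat.lt_succ_self K)
    -- `ε₁ := θBal(n)` and its four smallness conditions
    have hFL : 1 ≤ F.L := F.hL.2.le
    set ε₁ := θBal F.L γ b₀ p₀ (K / m) with hε₁_def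
    have hε₁ : 0 < ε₁ := θBal_pos hFL hγ hγ1 hb p₀ (K / m)
    have hθσ : ε₁ ≤ σ := by rw [hε₁_def, hF]; exact hθ γ hγ hγ₁' (K / m)
    have hε₁a : ε₁ ≤ a₁ := hθσ.trans (min_le_left _ _)
    have hε₂ : ε₁ ≤ ε₀ / (2 * B₃) := hθσ.trans ((min_le_right _ _).trans (min_le_left _ _))
    have hε₃ : ε₁ ≤ 1 / (C₀ * B₃) := hθσ.trans ((min_le_right _ _).trans ((min_le_right _ _).trans (min_le_left _ _)))
    have hε₄ : ε₁ ≤ c₂' / B₃ := hθσ.trans ((min_le_right _ _).trans ((min_le_right _ _).trans (min_le_right _ _)))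
    have h2 : 2 * (B₃ * ε₁) ≤ ε₀ := by
      have h := mul_le_mul_of_nonneg_left hε₂ (by positivity : (0 : ℝ) ≤ 2 * B₃)
      rwa [mul_div_cancel₀ _ (by positivity : (2 : ℝ) * B₃ ≠ 0), show 2 * B₃ * ε₁ = 2 * (B₃ * ε₁) by ring] at h
    have hlo : B₃ * ε₁ ≤ ε₀ := by nlinarith [mul_pos hB₃ hε₁]
    have hC : C₀ * (B₃ * ε₁) ≤ 1 := by
      have h := mul_le_mul_of_nonneg_left hε₃ (by positivity : (0 : ℝ) ≤ C₀ * B₃)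
      rwa [mul_div_cancel₀ _ (by positivity : C₀ * B₃ ≠ 0), show C₀ * B₃ * ε₁ = C₀ * (B₃ * ε₁) by ring] at h
    have hc : B₃ * ε₁ ≤ c₂' := by
      have h := mul_le_mul_of_nonneg_left hε₄ hB₃.le
      rwa [mul_div_cancel₀ _ hB₃.ne'] at h
    -- the minimiser `U′` of run `K+1` is critical hence in (8)
    have hmin := isMinOn_of_eq_minActionRegPr F hU'min
    have hU'8 : U' ∈ regFibrePr F (K / m) (K + 1) (hnK'.le) (B₃ * ε₁) V :=
      h8 F hF (K / m) (K + 1) hnK' ε₁ ε₀ hε₁ hε₁a hlo hε₀a V hV U' hU' hmin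
    -- the competitor: its one-step average
    refine ⟨descendTo F ℰp K (K + 1) (Nat.le_succ K) U', ?_, hineq K hK₀ V hV U' hU'8 hmin⟩
    exact descendTo_mem_regFibrePr F hB₃ hP1 hdiv hF hnK hε₁ hε₁a hlo hε₀a hc hC h2 hV hU'8 hmin
  · -- no member of the family has block size `L < 1`
    refine ⟨1, one_pos, fun F γ hF _ _ _ => ?_⟩
    exact absurd (hF ▸ F.hL.2.le) hL

end Composition

end Literature.MathematicalPhysics.QuantumFieldTheory.Balaban1983to89.T3LowerAlongMinimisersSplit

end
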